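import Summits.CriticalPhenomena.SAWScalingLimit.Theorems.SAWRenewalTightnessTubeLowerBoundOctantReduction
import Summits.CriticalPhenomena.SAWScalingLimit.Theorems.SAWRenewalTightnessTubeLowerBoundDiamondStaircase
import Summits.CriticalPhenomena.SAWScalingLimit.Theorems.SAWRenewalTightnessTubeLowerBoundKestenTilt
import Summits.CriticalPhenomena.SAWScalingLimit.Theorems.SAWRenewalTightnessTubeLowerBoundConeToDiamond
import Summits.CriticalPhenomena.SAWScalingLimit.Theorems.SAWRenewalTightnessTubeLowerBoundBPDOfSpanHyperscaling
import Summits.CriticalPhenomena.SAWScalingLimit.Theorems.SAWRenewalTightnessTubeLowerBoundSpanFloorVertex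
import Summits.CriticalPhenomena.SAWScalingLimit.Theorems.SAWRenewalTightnessTubeLowerBoundLacunaryRenewal
import Literature.Probability.RandomPlanarGeometry.SAWRenewalBound

/-!
# Line `subcritical-renewal-floor` — skeleton for the crux `SAWRenewalTightness.TubeLowerBound`
(crux item stmt-CriticalPhenomena-4730; lead c3 `prover-line-stmt-CriticalPhenomena-4730-c3-0`, 2026-08-16;
RESHAPE of the planner's checked skeleton `Cruxes/TubeLowerBound/Lines/subcritical-renewal-floor.lean`
(planner-cruxplan-stmt-CriticalPhenomena-4730-subcritical-renewal--0, rev 2, sha aa7e283b6144))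

Crux (FIXED, by name): `TubeLowerBound`.

## The line after the reshape (5 registered stubs, glued by `TubeLowerBound_of`; after wave 1: S1 LANDED p118515, S5 LANDED p116804, open: S2, S3 (research-level), S4 (XL engine, audited correct))

The idea is the planner's (multi-scale TILTED Kesten renewal below `x_c`, MS 1993 §4.2): S1 `stub_kestenTilt`
(exactly tilted pairs `(z, m)` exist for every small tilt rate `m`, print: MS Prop. 4.1.1(b), Cor. 4.1.15–16,
(4.2.12)–(4.2.15)), S2 `stub_spanHyperscaling` (OPEN, hardest: uniform normalised second span moment of the
tilted irreducible-bridge law), S3 `stub_transversalHyperscaling` (OPEN: transversal moments), S4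
`stub_renewalEngine` (S1 → S2 → S3 → `ConeBridgeFloor`, XL classical probability), and — the reshape — S5
`stub_coneToDiamond : ConeBridgeFloor → DiamondPieceFloor` (M, lattice geometry: a co-bridge with START cone
followed by a cone-bridge with END cone is a DIAMOND PIECE of the sibling line `bridge-doubling-tower`), after
which the composition is the LANDED chain `BridgeDoublingTower.stub_diamondStaircase` (p113072:
`DiamondPieceFloor → FirstOctantTubeFloor`) ∘ `LiebSimonStar.stub_octantReduction` (`→ TightTubeFloor`) ∘
`LiebSimonStar.tightTubeFloor_iff_crux` (`↔ TubeLowerBound`, from the landed `Negative.tightTubeFloor_iff`).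
The planner's S5 `staircaseAssembly : ConeBridgeFloor → TightTubeFloor` (a third staircase, size L) is thereby
replaced by an M-sized gluing lemma plus landed theorems; statements S1–S4 and `ConeBridgeFloor` are the
planner's VERBATIM (S1 is registered in DEF-FREE form, `stub_kestenTilt`, so that its Theorems file needs no Defs
file; `kestenTiltExists_of_stub` is the one-line glue back to the planner's `KestenTiltExists`).

Disproof.lean (cdisprove cycles 1–2, `Cruxes/TubeLowerBound/Disproof.lean` v2 05:33Z, read 2026-08-16T16:30Z) and
the landed `Theorems/TubeLowerBound/Negative/{TubeLowerBoundLoadBearing,TubeLowerBoundFixedWidth,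
SubcriticalRenewalFloorTargets}` honoured exactly as in the planner's docstring (criticality via S1/S4 only,
every tube widens with the span, `+2`/`∃N`/`0 ≤ C` kept); in addition `Negative.coneBridgeFloor_kappa_le`
(any `ConeBridgeFloor` witness has `κ ≤ 1/4`) is USED by S5: the diamond pieces are assembled at `t = 0` only, and
the tube `|y| ≤ κ s/4 + 1 ≤ s/16 + 1` of each half fits the diamond's `10|y| ≤ s` for `s ≥ 38` (smaller spans:
the straight walk).  No stub is an instance of a refuted variant (`WithoutSlack`/`WithoutDist`/`AllN`/
`AtFugacity x<x_c`); `ledger negatives`: nothing on bridges / renewal / tube floors.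
-/

noncomputable section

namespace Summit.CriticalPhenomena.SAWScalingLimit.Cruxes.TubeLowerBound.SubcriticalRenewalFloor

open scoped BigOperators Classical
open Literature.Probability.LatticeModels
open Literature.Probability.RandomPlanarGeometry Literature.Probability.RandomPlanarGeometry.SAW
open Summit.CriticalPhenomena.SAWScalingLimit.Theses.SAWRenewalTightness
open Summit.CriticalPhenomena.SAWScalingLimit.Theorems.TubeLowerBound.LiebSimonStar
  (FirstOctantTubeFloor TightTubeFloor stub_octantReduction tightTubeFloor_iff_crux)
open Summit.CriticalPhenomena.SAWScalingLimit.Theorems.TubeLowerBound.BridgeDoublingTower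
  (stub_diamondStaircase)

/-! ## Objects: Kesten's tilted irreducible-bridge law (MS 1993, (4.2.11), (4.2.27)) over the word model
(planner's definitions, verbatim) -/

/-- The irreducible bridges (Kesten 1963 §4; MS Def. 4.2.1) with `n` steps from the origin, as step words
(`SAW.IsIrrBridge` of `SAWWordBridges.lean`: self-avoiding, `0 < x(i) ≤ x(n)`, no break point, non-empty).
[cite: MadrasSlade1993, Definition 4.2.1] -/
def irrWords (n : ℕ) : Finset (List Step) :=
  (sawWords n).filter fun w => IsIrrBridge w

/-- Transversal endpoint displacement `Y(w)` (second coordinate of the endpoint). [cite: MadrasSlade1993, (4.2.27)] -/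
def yEnd (w : List Step) : ℤ := wEnd w 1

/-- Transversal excursion radius `R(w) = max_{0 ≤ i ≤ |w|} |y(i)|` (so `|Y(w)| ≤ R(w)`). [folklore] -/
def yRad (w : List Step) : ℕ := (Finset.range (w.length + 1)).sup fun i => (traj w i 1).natAbs

/-- The TILTED weight `z^{|w|} e^{m · span(w)}` of a word (`span = xEnd`). [cite: MadrasSlade1993, (4.2.11)] -/
def tiltWeight (z m : ℝ) (w : List Step) : ℝ := z ^ w.length * Real.exp (m * (xEnd w : ℝ))

/-- `TiltHasSum z m f S`: the tilted functional `Σ_{w irreducible bridge} f(w) z^{|w|} e^{m·span(w)}` converges (as the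
series over the length `n` of the finite sums over `irrWords n`) to `S`. [cite: MadrasSlade1993, (4.2.27)] -/
def TiltHasSum (z m : ℝ) (f : List Step → ℝ) (S : ℝ) : Prop :=
  HasSum (fun n : ℕ => ∑ w ∈ irrWords n, f w * tiltWeight z m w) S

/-- `(z, m)` is an exactly tilted (Kesten) pair: `0 < z ≤ x_c`, `m > 0`, and the tilted weights of all irreducible bridges
sum to exactly `1` (MS (4.2.15)). [cite: MadrasSlade1993, (4.2.15)] -/
def IsKestenTilt (z m : ℝ) : Prop :=
  0 < z ∧ z ≤ criticalFugacity ∧ 0 < m ∧ TiltHasSum z m (fun _ => 1) 1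

/-! ## The statements of the line (planner's, verbatim; plus `DiamondPieceFloor` of the sibling line) -/

/-- **S1 (known).** Every small tilt rate is realised below `x_c`, at a fugacity bounded away from `0`.
[cite: MadrasSlade1993, (4.2.15)] -/
def KestenTiltExists : Prop :=
  ∃ m₀ : ℝ, 0 < m₀ ∧ ∀ m : ℝ, 0 < m → m ≤ m₀ →
    ∃ z : ℝ, criticalFugacity / 2 ≤ z ∧ IsKestenTilt z m

/-- **S2 (open; the load-bearing physical input).** Longitudinal single-scale hyperscaling of the tilted span law:
`E[X²] ≤ (C/m) E[X]` uniformly over exactly tilted pairs with `m ≤ m₀`. [cite: MadrasSlade1993, Theorem 4.2.4] -/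
def SpanHyperscaling : Prop :=
  ∃ C m₀ : ℝ, 0 < m₀ ∧ ∀ z m : ℝ, IsKestenTilt z m → m ≤ m₀ →
    ∃ S₁ S₂ : ℝ, TiltHasSum z m (fun w => (xEnd w : ℝ)) S₁ ∧
      TiltHasSum z m (fun w => (xEnd w : ℝ) ^ 2) S₂ ∧ S₂ ≤ C / m * S₁

/-- **S3 (open).** Transversal single-scale hyperscaling of the tilted piece law, two-sided, with one `(2+η)`-moment.
[cite: MadrasSlade1993, Theorem 4.2.6 and Lemma 4.2.7] -/
def TransversalHyperscaling : Prop :=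
  ∃ C c η m₀ : ℝ, 0 < c ∧ 0 < η ∧ 0 < m₀ ∧ ∀ z m : ℝ, IsKestenTilt z m → m ≤ m₀ →
    ∃ S₁ T V W : ℝ, TiltHasSum z m (fun w => (xEnd w : ℝ)) S₁ ∧
      TiltHasSum z m (fun w => min ((yEnd w : ℝ) ^ 2) (m⁻¹ ^ 2)) T ∧
      TiltHasSum z m (fun w => (yRad w : ℝ) ^ 2) V ∧
      TiltHasSum z m (fun w => (yRad w : ℝ) ^ (2 + η)) W ∧
      c * m⁻¹ * S₁ ≤ T ∧ V ≤ C * m⁻¹ * S₁ ∧ W ≤ C * m⁻¹ ^ (1 + η) * S₁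

/-- **C⁺ = `ConeBridgeFloor`** (output of S4, input of S5): a polynomial floor for cone-tapered, tube-confined,
exactly-ending `e₁`-bridges `0 → (s, t)`, `|t| ≤ κ s` (any witness has `κ ≤ 1/4`, `Negative.coneBridgeFloor_kappa_le`).
[folklore] -/
def ConeBridgeFloor : Prop :=
  ∃ κ C c : ℝ, 0 < κ ∧ 0 < c ∧ ∀ (s : ℕ) (t : ℤ), 1 ≤ s → |(t : ℝ)| ≤ κ * s →
    ∃ N : ℕ, c * (s : ℝ) ^ (-C) ≤ ∑ n ∈ Finset.range (N + 1),
      ∑ _ω ∈ (Zd.bridges 2 n).filter (fun ω => ω n = ![(s : ℤ), t] ∧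
          ∀ i ≤ n, |((ω i 1 : ℤ) : ℝ) - (t : ℝ) / (s : ℝ) * ((ω i 0 : ℤ) : ℝ)| ≤ κ * s / 4 + 1 ∧
            4 * |ω i 1 - t| ≤ (s : ℤ) - ω i 0),
        criticalFugacity ^ n

/-- **Milestone `SpanRenewalFloor`** (triage O5; planner's statement verbatim): the `x_c`-mass of bridges of span `s` from
the origin is `≥ c s^{−C}` (some partial sum).  After lead c3's wave 2 it FOLLOWS FROM S2 ALONE (S1 landed):
`spanRenewalFloor_of_spanHyperscaling` below. [cite: MadrasSlade1993, §4.2 (4.2.16) and p. 92] -/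
def SpanRenewalFloor : Prop :=
  ∃ C c : ℝ, 0 < c ∧ ∀ s : ℕ, 1 ≤ s → ∃ N : ℕ, c * (s : ℝ) ^ (-C) ≤
    ∑ n ∈ Finset.range (N + 1), ∑ _ω ∈ (Zd.bridges 2 n).filter (fun ω => ω n 0 = (s : ℤ)), criticalFugacity ^ n

/-- **`DiamondPieceFloor`** (the sibling line's S2 output / S3 input, verbatim the hypothesis of the landed
`BridgeDoublingTower.stub_diamondStaircase`): diamond pieces of every span `s ≥ 1` — self-avoiding walks `0 → (s, 0)`
whose points at times `1 ≤ i < n` satisfy `|y| < x` and `|y| < s − x`, and all of whose points satisfy `10|y| ≤ s` —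
have `x_c`-mass `≥ c s^{−C}` (some partial sum). [folklore] -/
def DiamondPieceFloor : Prop :=
  ∃ C c : ℝ, 0 ≤ C ∧ 0 < c ∧ ∀ s : ℕ, 1 ≤ s → ∃ N : ℕ,
    c * (s : ℝ) ^ (-C) ≤
      ∑ n ∈ Finset.range (N + 1),
        ∑ _ω ∈ (SAW.Zd.saws 2 n).filter (fun ω =>
            ω n 0 = (s : ℤ) ∧ ω n 1 = 0 ∧
            (∀ i, 1 ≤ i → i < n → |ω i 1| < ω i 0 ∧ |ω i 1| < (s : ℤ) - ω i 0) ∧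
            (∀ i ≤ n, 10 * |ω i 1| ≤ (s : ℤ))),
          SAW.criticalFugacity ^ n

/-! ## Registered stubs (`sorry` only here) -/

/-- **S1 `stub_kestenTilt`** — `KestenTiltExists` in DEF-FREE form (so that the Theorems file
`SAWRenewalTightnessTubeLowerBoundKestenTilt.lean` can state it with tree vocabulary only): there is `m₀ > 0` such that
for every `m ∈ (0, m₀]` some `z ∈ [x_c/2, x_c]` makes `Σ_{w irreducible bridge} z^{|w|} e^{m·span(w)} = 1` (as the
`HasSum` over the length of the finite sums over `(sawWords n).filter IsIrrBridge`).  Print: MS Prop. 4.1.1(b), Cor.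
4.1.15–16 (`m(z)` continuous, strictly decreasing, `→ 0` as `z ↑ z_c`), Thm 4.1.14 (`m = M̄`), (4.2.12)–(4.2.15)
(`Σ_L A_z(L) e^{m(z) L} = 1` for `z < z_c`, via `a_L ≥ χ(z)^{−2}`), and the intermediate value theorem; in tree:
`SAWMassNorm` (named facts `MadrasSlade1993_prop_4_1_1b/_cor_4_1_15/_cor_4_1_16`, UNPROVED), `SAWWordBridges`,
`SAWRenewalBound`, `Theorems.SAWRenewalTightnessKestenIdentity*` (the `z = x_c`, `m = 0` shadow, proved).  Size L. -/
theorem stub_kestenTilt :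
    ∃ m₀ : ℝ, 0 < m₀ ∧ ∀ m : ℝ, 0 < m → m ≤ m₀ →
      ∃ z : ℝ, criticalFugacity / 2 ≤ z ∧ 0 < z ∧ z ≤ criticalFugacity ∧
        HasSum (fun n : ℕ => ∑ w ∈ (sawWords n).filter (fun w => IsIrrBridge w),
          z ^ w.length * Real.exp (m * (xEnd w : ℝ))) 1 :=
  Summit.CriticalPhenomena.SAWScalingLimit.Theorems.TubeLowerBound.SubcriticalRenewalFloor.stub_kestenTilt
  -- LANDED p118515 (lead c3 wave 1; parts p117656, p118085), UNCONDITIONAL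

/-- **S2 `stub_spanHyperscaling`** — `SpanHyperscaling`: the HARDEST stub, open (lead's). -/
theorem stub_spanHyperscaling : SpanHyperscaling := by
  sorry

/-- **S3 `stub_transversalHyperscaling`** — `TransversalHyperscaling`; open. -/
theorem stub_transversalHyperscaling : TransversalHyperscaling := by
  sorry

/-- **S4 `stub_renewalEngine`** — the multi-scale tilted renewal chain: S1 → S2 → S3 → `ConeBridgeFloor` (planner's
statement verbatim; size XL: Lorden windows, Rademacher steering with Berry–Esseen/Lévy, unit atoms at the last scale,
injectivity by unique Kesten factorisation `SAW.eq_of_append_eq`). -/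
theorem stub_renewalEngine :
    KestenTiltExists → SpanHyperscaling → TransversalHyperscaling → ConeBridgeFloor := by
  sorry

/-- **S5 `stub_coneToDiamond`** (LEAD RESHAPE of the planner's `staircaseAssembly`; provable now, M) —
`ConeBridgeFloor → DiamondPieceFloor`, both INLINED.  Proof route: let `(κ, C, c)` witness the hypothesis
(`κ ≤ 1/4` by `Negative.coneBridgeFloor_kappa_le`, or directly: the cone at `i = 0` forces `4|t| ≤ s`).  For a span
`s ≥ 38` put `s₁ = ⌈s/2⌉`, `s₂ = ⌊s/2⌋` (`1 ≤ s₂ ≤ s₁ ≤ s₂ + 1`).  Take a cone-bridge `β₂ : 0 → (s₂, 0)` (`t = 0`) and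
the CO-BRIDGE `β₁ : 0 → (s₁, 0)` obtained from a cone-bridge `β : 0 → (s₁, 0)` by rotation by `π` and time reversal,
`β₁ i = (s₁,0) − β (n − i)` (tree: reversal/negation lemmas `Zd.neg_mem_sawFun`, `countAt_neg`, or by hand): `β₁`
has `0 ≤ x < s₁` before its tip, START cone `4|y(i)| ≤ x(i)` and tube `|y| ≤ κ s₁/4 + 1`.  The concatenation
`β₁ ++ (β₂ + (s₁,0))` is self-avoiding (the pieces live in the columns `x ≤ s₁` resp. `x > s₁`, sharing only the apex
`(s₁,0)`: a bridge has `x > x(0)` after time `0`), ends at `(s, 0)`, and is a DIAMOND PIECE: interior points of the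
first half have `1 ≤ x` hence `|y| ≤ x/4 < x`, and `|y| ≤ x/4 < s − x` because `x < s₁ ≤ 4 s₂`...; interior points of
the second half have `|y| ≤ (s − x)/4 < s − x` and `(s − x)/4 < x` because `x > s₁ ≥ s/2`; every point has
`10|y| ≤ 10(κ s₁/4 + 1) ≤ 10(s₁/16 + 1) ≤ s` for `s ≥ 38`.  The map `(β, β₂) ↦` glued walk is injective (cut at the
unique visit to the column `x = s₁`... the glued walk visits column `s₁` possibly several times inside `β₁`; cut at the
LAST visit to column `s₁`, which is the apex since the second half has `x > s₁`), so the diamond mass of span `s` is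
`≥ (c s₁^{−C})(c s₂^{−C}) ≥ c² ((s+1)/2)^{−2|C|}·…`; take `C' = 2 max C 0 + …`, and for `s < 38` the straight walk
`SAW.Zd.straightWalk` (mass `x_c^s ≥ x_c^{37}`).  In-tree helpers: `Zd.mem_bridges`, `Zd.concatWalk`,
`Zd.concatWalk_mem_saws`, `CornerStaircase.tubeMass_concat` (gluing with a separation hypothesis),
`LiebSimonStar.steeredChain_glue_mass`, `MirrorPin.Glues`, `Real.rpow_le_rpow_of_nonpos`. -/
theorem stub_coneToDiamond :
    (∃ κ C c : ℝ, 0 < κ ∧ 0 < c ∧ ∀ (s : ℕ) (t : ℤ), 1 ≤ s → |(t : ℝ)| ≤ κ * s →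
      ∃ N : ℕ, c * (s : ℝ) ^ (-C) ≤ ∑ n ∈ Finset.range (N + 1),
        ∑ _ω ∈ (Zd.bridges 2 n).filter (fun ω => ω n = ![(s : ℤ), t] ∧
            ∀ i ≤ n, |((ω i 1 : ℤ) : ℝ) - (t : ℝ) / (s : ℝ) * ((ω i 0 : ℤ) : ℝ)| ≤ κ * s / 4 + 1 ∧
              4 * |ω i 1 - t| ≤ (s : ℤ) - ω i 0),
          criticalFugacity ^ n) →
    ∃ C c : ℝ, 0 ≤ C ∧ 0 < c ∧ ∀ s : ℕ, 1 ≤ s → ∃ N : ℕ,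
      c * (s : ℝ) ^ (-C) ≤
        ∑ n ∈ Finset.range (N + 1),
          ∑ _ω ∈ (SAW.Zd.saws 2 n).filter (fun ω =>
              ω n 0 = (s : ℤ) ∧ ω n 1 = 0 ∧
              (∀ i, 1 ≤ i → i < n → |ω i 1| < ω i 0 ∧ |ω i 1| < (s : ℤ) - ω i 0) ∧
              (∀ i ≤ n, 10 * |ω i 1| ≤ (s : ℤ))),
            SAW.criticalFugacity ^ n :=
  Summit.CriticalPhenomena.SAWScalingLimit.Theorems.TubeLowerBound.SubcriticalRenewalFloor.stub_coneToDiamond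
  -- LANDED p116804 (lead c3 wave 1)

/-! ## Proved glue -/

/-- S1 in def-free form gives the planner's `KestenTiltExists` (unfolding `IsKestenTilt`, `TiltHasSum`, `irrWords`,
`tiltWeight`; the weight `fun _ => 1` contributes a factor `1`). [folklore] -/
theorem kestenTiltExists_of_stub
    (h : ∃ m₀ : ℝ, 0 < m₀ ∧ ∀ m : ℝ, 0 < m → m ≤ m₀ →
      ∃ z : ℝ, criticalFugacity / 2 ≤ z ∧ 0 < z ∧ z ≤ criticalFugacity ∧
        HasSum (fun n : ℕ => ∑ w ∈ (sawWords n).filter (fun w => IsIrrBridge w),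
          z ^ w.length * Real.exp (m * (xEnd w : ℝ))) 1) :
    KestenTiltExists := by
  obtain ⟨m₀, hm₀, h⟩ := h
  refine ⟨m₀, hm₀, fun m hm hmm => ?_⟩
  obtain ⟨z, hz2, hz0, hzc, hsum⟩ := h m hm hmm
  refine ⟨z, hz2, hz0, hzc, hm, ?_⟩
  unfold TiltHasSum irrWords tiltWeight
  simpa only [one_mul] using hsum

/-- **Milestone O5 is downstream of S2 alone** (lead c3 wave 2, all LANDED): `SpanHyperscaling → SpanRenewalFloor`, by
`breakPointDensity_of_spanHyperscaling` (p122826: tilted pairs from the landed S1, fixed piece count + Chebyshev, un-tilting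
`e^{−2r}` ⇒ break-point density in dyadic span windows) and `spanRenewalFloor_of_breakPointDensity'` (p120206 + p121181:
renewal halving, cost `c₀` per dyadic level).  The complementary negative fact `lacunaryRenewal_noPolynomialFloor` (p120914)
shows the break-point density is NOT a consequence of the renewal structure alone. [folklore] -/
theorem spanRenewalFloor_of_spanHyperscaling (h : SpanHyperscaling) : SpanRenewalFloor := by
  have hdf : ∃ C m₀ : ℝ, 0 < m₀ ∧ ∀ z m : ℝ, 0 < z → z ≤ criticalFugacity → 0 < m → m ≤ m₀ →
      HasSum (fun n : ℕ => ∑ w ∈ (sawWords n).filter (fun w => IsIrrBridge w),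
        z ^ w.length * Real.exp (m * (xEnd w : ℝ))) 1 →
      ∃ S₁ S₂ : ℝ, HasSum (fun n : ℕ => ∑ w ∈ (sawWords n).filter (fun w => IsIrrBridge w),
          (xEnd w : ℝ) * (z ^ w.length * Real.exp (m * (xEnd w : ℝ)))) S₁ ∧
        HasSum (fun n : ℕ => ∑ w ∈ (sawWords n).filter (fun w => IsIrrBridge w),
          (xEnd w : ℝ) ^ 2 * (z ^ w.length * Real.exp (m * (xEnd w : ℝ)))) S₂ ∧ S₂ ≤ C / m * S₁ := by
    obtain ⟨C, m₀, hm₀, hh⟩ := h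
    refine ⟨C, m₀, hm₀, fun z m hz hzc hm hmm hsum => ?_⟩
    have htilt : IsKestenTilt z m := by
      refine ⟨hz, hzc, hm, ?_⟩
      unfold TiltHasSum irrWords tiltWeight
      simpa only [one_mul] using hsum
    obtain ⟨S₁, S₂, h1, h2, h12⟩ := hh z m htilt hmm
    unfold TiltHasSum irrWords tiltWeight at h1 h2
    exact ⟨S₁, S₂, h1, h2, h12⟩
  obtain ⟨C, c, -, hc, hfloor⟩ :=
    Summit.CriticalPhenomena.SAWScalingLimit.Theorems.TubeLowerBound.SubcriticalRenewalFloor.spanRenewalFloor_of_breakPointDensity'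
      (Summit.CriticalPhenomena.SAWScalingLimit.Theorems.TubeLowerBound.SubcriticalRenewalFloor.breakPointDensity_of_spanHyperscaling
        hdf)
  exact ⟨C, c, hc, hfloor⟩

/-- S5's hypothesis is literally `ConeBridgeFloor` and its conclusion literally `DiamondPieceFloor`. [folklore] -/
theorem diamondPieceFloor_of_coneBridgeFloor (h : ConeBridgeFloor) : DiamondPieceFloor :=
  stub_coneToDiamond h

/-! ## The composition: the five stubs give the crux BY NAME -/

/-- **`TubeLowerBound` from the line `subcritical-renewal-floor`** (kernel-checked, no `sorry` of its own): S1–S3 feed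
the renewal engine S4; its cone-bridge floor gives diamond pieces (S5), the LANDED diamond staircase
(`BridgeDoublingTower.stub_diamondStaircase`, p113072) gives `FirstOctantTubeFloor`, the LANDED octant reduction
(`LiebSimonStar.stub_octantReduction`) gives `TightTubeFloor`, which is the crux (`LiebSimonStar.tightTubeFloor_iff_crux`,
from the landed `Negative.tightTubeFloor_iff`). -/
theorem TubeLowerBound_of : TubeLowerBound :=
  tightTubeFloor_iff_crux.1
    (stub_octantReduction
      (stub_diamondStaircase
        (diamondPieceFloor_of_coneBridgeFloor
          (stub_renewalEngine (kestenTiltExists_of_stub stub_kestenTilt) stub_spanHyperscaling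
            stub_transversalHyperscaling))))

end Summit.CriticalPhenomena.SAWScalingLimit.Cruxes.TubeLowerBound.SubcriticalRenewalFloor

end
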